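import Literature.NumberTheory.GaloisRepresentations.RamificationSquareTwoProofs
import Literature.NumberTheory.GaloisRepresentations.QuadraticEisensteinRamificationProofs
import HarnessLib

/-!
# The lower filtration of a quadratic and of a biquadratic extension from Eisenstein and
# radical data: `#G_i` patterns `(2, 2, 2, 1)` and `(4, 4, 2, 2, 1)` (Serre, *Local Fields*, IV §1–2)

`Proofs` file (theorems only, no definitions, no named facts) in topic
`NumberTheory/GaloisRepresentations`, landed by the seat of
`WeierstrassCurve.conductorNatOf_geomPoints_eq_conductorNorm_of_isElliptic` (Ogg–Saito at `2` over
`ℚ`), companion of `RamificationSquareTwoProofs` (`lowerIndex_add_eq_of_biquadratic`: the indices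
of a four-group from its three quadratic quotients) and `QuadraticEisensteinRamificationProofs`
(the index of the non-trivial automorphism of a quadratic Eisenstein extension).  It turns these
into the **orders `#G_i` of the ramification groups** — the format consumed by the structure
theorems `ThreeTorsionTwoBreakSwanProofs` for the `3`-division field of an elliptic curve above
`2` (through `InertiaFieldLayer`, over the inertia field) — starting from **radicals**: elements
`θ` with `θ² = 2a` (`a` a unit) and units `P` negated by an automorphism, over a base with
`v_𝔭(2) = 1`.

* `lowerIndex_eq_ord_of_quadratic` — **`i_G(σ) = v_𝔓(2θ + c₁)`** for the non-trivial
  automorphism of a quadratic Eisenstein extension; `card_ramificationSubgroup_of_card_eq_two` —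
  **`#G_i = 2` for `i + 1 ≤ n`, `1` beyond** (`#G = 2`, non-trivial element of index `n`);
  `eq_of_card_eq_four`; `card_ramificationSubgroup_of_biquadratic_two_three_three` —
  **`(4, 4, 2, 2, 1)`** from quadratic indices `(2, 3, 3)`.
* Galois-setting wrappers (instances of the Dedekind/Galois setting supplied):
  `lowerIndex_le_of_ord_two_galois`, `sq_mem_ramificationSubgroup_min_galois` (Serre IV §2
  Ex. 3), `ramificationSubgroup_one_ne_bot_of_two_dvd_card_galois` (an even `#G₀` above `2` forces
  `G₁ ≠ 1`), `card_inertia_quotient_dvd`.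
* Radicals: `lowerIndex_eq_three_of_sq_eq_two_mul` — **index `3` for `√(2a)`**;
  `lowerIndex_eq_two_of_smul_eq_neg` — **index `2` for a unit `P` with `σP = -P`** in a totally
  ramified quadratic extension above `2` with `v_𝔭(2) = 1` (`σ ∈ G₁` by the wrapper, `σ ∉ G₂`
  as `v_𝔓(2P) = e ≤ 2`); `card_ramificationSubgroup_of_quadratic_radical` — **`(2, 2, 2, 1)`**.
* Sublevels: for an involution `z` of a Galois group of order `4`, the quadratic subfield
  `L^{⟨z⟩}` (`card_aut_fixedField_zpowers_eq_two`) and the copies in `S_{L^{⟨z⟩}}` of level-`L`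
  radicals fixed by `z`: `lowerIndex_restrictNormalHom_eq_three`, `lowerIndex_restrictNormalHom_eq_two`;
  assembled: `card_ramificationSubgroup_of_biquadratic_radical` — **`(4, 4, 2, 2, 1)` for
  `L = K(θ₂, θ₃)`, `θ_k² = 2a_k`, with `θ₂θ₃/2` a unit** acted on by signs (e.g. `ℚ₂(ζ₈)`).

## References

* J.-P. Serre, *Local Fields*, GTM 67 (1979), Ch. IV §1 (Lemma 1, Prop. 2–3, pp. 61–63), §2
  (Prop. 5, Cor. 1 of Prop. 7, Exercise 3 p. 71), Ch. I §7 (Prop. 22). [SerreLocalFields1979]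

## Design

Theorems only, namespace `Literature.NumberTheory.GaloisRepresentations`, generic Galois setting
`(R, K, L)` of `QuadraticEisensteinRamificationProofs`; the sublevel algebra
`integralClosure R E → integralClosure R L` of `RamificationGalois` as a local instance.
Axioms: `propext`, `Classical.choice`, `Quot.sound`.
-/

open scoped Pointwise

namespace Literature.NumberTheory.GaloisRepresentations

section Quadratic

variable {R : Type*} {K L : Type*} [CommRing R] [IsDedekindDomain R] [Field K] [Field L]
  [Algebra R K] [IsFractionRing R K] [Algebra R L] [Algebra K L] [IsScalarTower R K L]
  [FiniteDimensional K L] [IsGalois K L]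
  (𝔓 : Ideal (integralClosure R L)) [𝔓.IsMaximal]

include K in
/-- **`i_G(σ) = v_𝔓(2θ + c₁)`** for the non-trivial automorphism of a quadratic Eisenstein
extension (`mem_ramificationSubgroup_iff_of_quadratic` for all `i`).
[cite: SerreLocalFields1979, Ch. IV §1 Lemma 1 and Prop. 2] -/
theorem lowerIndex_eq_ord_of_quadratic
    [Algebra.IsSeparable (R ⧸ 𝔓.under R) (integralClosure R L ⧸ 𝔓)]
    (h𝔓 : 𝔓 ≠ ⊥) (hG : Nat.card (L ≃ₐ[K] L) = 2) {θ : integralClosure R L} {c₁ c₀ : R}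
    (hθ : θ ^ 2 + algebraMap R _ c₁ * θ + algebraMap R _ c₀ = 0)
    (hc₁ : c₁ ∈ 𝔓.under R) (hc₀ : c₀ ∈ 𝔓.under R) (hc₀' : c₀ ∉ (𝔓.under R) ^ 2)
    {σ : L ≃ₐ[K] L} (hσ : σ • θ ≠ θ) :
    lowerIndex 𝔓 (L ≃ₐ[K] L) σ = ord 𝔓 (2 * θ + algebraMap R _ c₁) := by
  haveI : IsDedekindDomain (integralClosure R L) := integralClosure.isDedekindDomain R K L
  have key : ∀ i : ℕ, (i : ℕ∞) + 1 ≤ lowerIndex 𝔓 (L ≃ₐ[K] L) σ ↔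
      (i : ℕ∞) + 1 ≤ ord 𝔓 (2 * θ + algebraMap R _ c₁) := by
    intro i
    rw [add_one_le_lowerIndex_iff, mem_ramificationSubgroup_iff_of_quadratic (K := K) 𝔓 h𝔓 hG hθ
      hc₁ hc₀ hc₀' hσ i, mem_pow_iff_le_ord]
    push_cast
    rfl
  apply le_antisymm
  · rw [← ENat.forall_natCast_le_iff_le]
    intro n hn
    rcases n with _ | n
    · exact bot_le
    · have := (key n).mp (by exact_mod_cast hn)
      exact_mod_cast this
  · rw [← ENat.forall_natCast_le_iff_le]
    intro n hn
    rcases n with _ | n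
    · exact bot_le
    · have := (key n).mpr (by exact_mod_cast hn)
      exact_mod_cast this

omit [IsDedekindDomain R] [IsFractionRing R K] [IsGalois K L] [𝔓.IsMaximal] in
/-- **The filtration of a quadratic extension with its non-trivial element of index `n`**:
`#G_i = 2` for `i + 1 ≤ n` and `#G_i = 1` for `n ≤ i` (`#G = 2`).
[cite: SerreLocalFields1979, Ch. IV §1 Prop. 2 ff.] -/
theorem card_ramificationSubgroup_of_card_eq_two (hG : Nat.card (L ≃ₐ[K] L) = 2)
    {σ : L ≃ₐ[K] L} (hσ : σ ≠ 1) {n : ℕ} (hn : lowerIndex 𝔓 (L ≃ₐ[K] L) σ = n) (i : ℕ) :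
    Nat.card (𝔓.ramificationSubgroup (L ≃ₐ[K] L) i) = if i + 1 ≤ n then 2 else 1 := by
  classical
  -- `G = {1, σ}`
  have hall : ∀ g : L ≃ₐ[K] L, g = 1 ∨ g = σ := by
    intro g
    by_contra h
    push Not at h
    haveI : Fintype (L ≃ₐ[K] L) := Fintype.ofFinite _
    have h3 : ({1, σ, g} : Finset (L ≃ₐ[K] L)).card = 3 := by
      rw [Finset.card_insert_of_notMem, Finset.card_pair (Ne.symm h.2)]
      simp only [Finset.mem_insert, Finset.mem_singleton, not_or]
      exact ⟨Ne.symm hσ, Ne.symm h.1⟩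
    have hle : ({1, σ, g} : Finset (L ≃ₐ[K] L)).card ≤ Fintype.card (L ≃ₐ[K] L) :=
      Finset.card_le_univ _
    rw [h3, ← Nat.card_eq_fintype_card, hG] at hle
    omega
  have hmemσ : σ ∈ 𝔓.ramificationSubgroup (L ≃ₐ[K] L) i ↔ i + 1 ≤ n := by
    rw [← add_one_le_lowerIndex_iff, hn]
    exact_mod_cast Iff.rfl
  by_cases hi : i + 1 ≤ n
  · rw [if_pos hi]
    have htop : 𝔓.ramificationSubgroup (L ≃ₐ[K] L) i = ⊤ := by
      ext g
      simp only [Subgroup.mem_top, iff_true]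
      rcases hall g with rfl | rfl
      · exact Subgroup.one_mem _
      · exact hmemσ.mpr hi
    rw [htop, Subgroup.card_top, hG]
  · rw [if_neg hi]
    have hbot : 𝔓.ramificationSubgroup (L ≃ₐ[K] L) i = ⊥ := by
      rw [Subgroup.eq_bot_iff_forall]
      intro g hg
      rcases hall g with rfl | rfl
      · rfl
      · exact absurd (hmemσ.mp hg) hi
    rw [hbot, Subgroup.card_bot]

end Quadratic

section Biquadratic

variable (R : Type*) {K L : Type*} [CommRing R] [IsDedekindDomain R] [Field K] [Field L]
  [Algebra R K] [IsFractionRing R K] [Algebra R L] [Algebra K L] [IsScalarTower R K L]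
  [FiniteDimensional K L] [IsGalois K L]
  (𝔓 : Ideal (integralClosure R L)) [𝔓.IsMaximal]
  [Algebra.IsSeparable (R ⧸ 𝔓.under R) (integralClosure R L ⧸ 𝔓)]

/-- In a group of order `4` two distinct commuting involutions `z₁, z₂ ≠ 1` and their product
exhaust the group: every element is `1, z₁, z₂` or `z₁z₂`. [folklore] -/
theorem eq_of_card_eq_four {G : Type*} [Group G] [Finite G] (hG : Nat.card G = 4) {z₁ z₂ : G}
    (h22 : z₂ * z₂ = 1) (hz₁ : z₁ ≠ 1) (hz₂ : z₂ ≠ 1) (h12 : z₁ ≠ z₂) (g : G) :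
    g = 1 ∨ g = z₁ ∨ g = z₂ ∨ g = z₁ * z₂ := by
  classical
  by_contra h
  push Not at h
  haveI : Fintype G := Fintype.ofFinite _
  have hz₃1 : z₁ * z₂ ≠ 1 := by
    intro h'
    apply h12
    calc z₁ = z₁ * (z₂ * z₂) := by rw [h22, mul_one]
      _ = z₁ * z₂ * z₂ := by rw [mul_assoc]
      _ = z₂ := by rw [h', one_mul]
  have hz₃z₁ : z₁ * z₂ ≠ z₁ := by
    intro h'; apply hz₂
    have : z₁ * z₂ = z₁ * 1 := by rw [mul_one]; exact h'
    exact mul_left_cancel this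
  have hz₃z₂ : z₁ * z₂ ≠ z₂ := by
    intro h'; apply hz₁
    have : z₁ * z₂ = 1 * z₂ := by rw [one_mul]; exact h'
    exact mul_right_cancel this
  have h5 : ({1, z₁, z₂, z₁ * z₂, g} : Finset G).card = 5 := by
    rw [Finset.card_insert_of_notMem, Finset.card_insert_of_notMem, Finset.card_insert_of_notMem,
      Finset.card_pair (Ne.symm h.2.2.2)]
    · simp only [Finset.mem_insert, Finset.mem_singleton, not_or]
      exact ⟨hz₃z₂.symm, (Ne.symm h.2.2.1)⟩
    · simp only [Finset.mem_insert, Finset.mem_singleton, not_or]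
      exact ⟨h12, hz₃z₁.symm, Ne.symm h.2.1⟩
    · simp only [Finset.mem_insert, Finset.mem_singleton, not_or]
      exact ⟨Ne.symm hz₁, Ne.symm hz₂, Ne.symm hz₃1, Ne.symm h.1⟩
  have hle : ({1, z₁, z₂, z₁ * z₂, g} : Finset G).card ≤ Fintype.card G := Finset.card_le_univ _
  rw [h5, ← Nat.card_eq_fintype_card, hG] at hle
  omega

set_option synthInstance.maxHeartbeats 400000 in
/-- **The filtration `(4, 4, 2, 2, 1)` of a totally ramified biquadratic extension with quadratic
indices `(2, 3, 3)`.**  `R` Dedekind with fraction field `K`, `L/K` Galois of order `4`,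
`z₁, z₂ ∈ G₀` commuting involutions with `z₁, z₂, z₁z₂` distinct and `≠ 1` (so `G = G₀ =
{1, z₁, z₂, z₁z₂}`), `𝔓` a maximal ideal of `S_L` with separable residue extension, and for the
three quadratic subfields `E_j` (fixed fields of `z₁`, `z₂`, `z₁z₂`) the non-trivial restrictions
have indices `n₁ = 2`, `n₂ = 3`, `n₃ = 3` at `𝔓 ∩ E_j`.  Then `i(z₁) = 4`, `i(z₂) = i(z₁z₂) = 2`
(`lowerIndex_add_eq_of_biquadratic`), hence **`#G₀ = #G₁ = 4`, `#G₂ = #G₃ = 2`, `#G₄ = 1`**.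
(Over `ℚ₂`: the compositum of `√u`, `u ≡ 3 (4)`-type, break `1`, with `√(2u')`, break `2`.)
[cite: SerreLocalFields1979, Ch. IV §1 Prop. 2–3 (p. 62–63)] -/
theorem card_ramificationSubgroup_of_biquadratic_two_three_three
    (hG : Nat.card (L ≃ₐ[K] L) = 4)
    (E₁ E₂ E₃ : IntermediateField K L) [Normal K E₁] [Normal K E₂] [Normal K E₃]
    {z₁ z₂ : L ≃ₐ[K] L} (h11 : z₁ * z₁ = 1) (h22 : z₂ * z₂ = 1) (hcomm : z₁ * z₂ = z₂ * z₁)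
    (hz₁ : z₁ ≠ 1) (hz₂ : z₂ ≠ 1) (h12 : z₁ ≠ z₂)
    (hz₁0 : z₁ ∈ 𝔓.ramificationSubgroup (L ≃ₐ[K] L) 0)
    (hz₂0 : z₂ ∈ 𝔓.ramificationSubgroup (L ≃ₐ[K] L) 0)
    (hker₁ : ∀ σ : L ≃ₐ[K] L, AlgEquiv.restrictNormalHom E₁ σ = 1 ↔ σ = 1 ∨ σ = z₁)
    (hker₂ : ∀ σ : L ≃ₐ[K] L, AlgEquiv.restrictNormalHom E₂ σ = 1 ↔ σ = 1 ∨ σ = z₂)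
    (hker₃ : ∀ σ : L ≃ₐ[K] L, AlgEquiv.restrictNormalHom E₃ σ = 1 ↔ σ = 1 ∨ σ = z₁ * z₂)
    (hn₁ : lowerIndex (𝔓.comap (E₁.integralClosureInclusion R)) (E₁ ≃ₐ[K] E₁)
      (AlgEquiv.restrictNormalHom E₁ z₂) = (2 : ℕ))
    (hn₂ : lowerIndex (𝔓.comap (E₂.integralClosureInclusion R)) (E₂ ≃ₐ[K] E₂)
      (AlgEquiv.restrictNormalHom E₂ z₁) = (3 : ℕ))
    (hn₃ : lowerIndex (𝔓.comap (E₃.integralClosureInclusion R)) (E₃ ≃ₐ[K] E₃)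
      (AlgEquiv.restrictNormalHom E₃ z₁) = (3 : ℕ)) :
    Nat.card (𝔓.ramificationSubgroup (L ≃ₐ[K] L) 0) = 4 ∧
      Nat.card (𝔓.ramificationSubgroup (L ≃ₐ[K] L) 1) = 4 ∧
      Nat.card (𝔓.ramificationSubgroup (L ≃ₐ[K] L) 2) = 2 ∧
      Nat.card (𝔓.ramificationSubgroup (L ≃ₐ[K] L) 3) = 2 ∧
      Nat.card (𝔓.ramificationSubgroup (L ≃ₐ[K] L) 4) = 1 := by
  classical
  obtain ⟨ha, hb, hc⟩ := lowerIndex_add_eq_of_biquadratic R 𝔓 E₁ E₂ E₃ h11 h22 hcomm hz₁ hz₂ h12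
    hz₁0 hz₂0 hker₁ hker₂ hker₃ hn₁ hn₂ hn₃
  -- the three indices
  have hiz₁ : lowerIndex 𝔓 (L ≃ₐ[K] L) z₁ = (4 : ℕ) := by
    have h4 : lowerIndex 𝔓 (L ≃ₐ[K] L) z₁ + (2 : ℕ) = ((4 : ℕ) : ℕ∞) + (2 : ℕ) := by
      rw [ha]; norm_num
    exact WithTop.add_right_cancel (by exact_mod_cast ENat.coe_ne_top 2) h4
  have hiz₂ : lowerIndex 𝔓 (L ≃ₐ[K] L) z₂ = (2 : ℕ) := by
    have h4 : lowerIndex 𝔓 (L ≃ₐ[K] L) z₂ + (3 : ℕ) = ((2 : ℕ) : ℕ∞) + (3 : ℕ) := by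
      rw [hb]; norm_num
    exact WithTop.add_right_cancel (by exact_mod_cast ENat.coe_ne_top 3) h4
  have hiz₃ : lowerIndex 𝔓 (L ≃ₐ[K] L) (z₁ * z₂) = (2 : ℕ) := by
    have h4 : lowerIndex 𝔓 (L ≃ₐ[K] L) (z₁ * z₂) + (3 : ℕ) = ((2 : ℕ) : ℕ∞) + (3 : ℕ) := by
      rw [hc]; norm_num
    exact WithTop.add_right_cancel (by exact_mod_cast ENat.coe_ne_top 3) h4
  have hall := eq_of_card_eq_four hG h22 hz₁ hz₂ h12
  -- membership of the four elements in `G_i`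
  have mem_iff : ∀ (g : L ≃ₐ[K] L) (m : ℕ), lowerIndex 𝔓 (L ≃ₐ[K] L) g = m →
      ∀ i, g ∈ 𝔓.ramificationSubgroup (L ≃ₐ[K] L) i ↔ i + 1 ≤ m := by
    intro g m hm i
    rw [← add_one_le_lowerIndex_iff, hm]
    exact_mod_cast Iff.rfl
  have m₁ := mem_iff z₁ 4 hiz₁
  have m₂ := mem_iff z₂ 2 hiz₂
  have m₃ := mem_iff (z₁ * z₂) 2 hiz₃
  -- `G_i = ⊤` for `i ≤ 1`
  have htop : ∀ i, i ≤ 1 → 𝔓.ramificationSubgroup (L ≃ₐ[K] L) i = ⊤ := by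
    intro i hi
    ext g
    simp only [Subgroup.mem_top, iff_true]
    rcases hall g with rfl | rfl | rfl | rfl
    · exact Subgroup.one_mem _
    · exact (m₁ i).mpr (by omega)
    · exact (m₂ i).mpr (by omega)
    · exact (m₃ i).mpr (by omega)
  -- `G_i = {1, z₁}` for `i ∈ {2, 3}`
  have hz₁ord : orderOf z₁ = 2 := orderOf_eq_prime (by rw [pow_two]; exact h11) hz₁
  have hmid : ∀ i, 2 ≤ i → i ≤ 3 → 𝔓.ramificationSubgroup (L ≃ₐ[K] L) i = Subgroup.zpowers z₁ := by
    intro i hi2 hi3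
    ext g
    rw [mem_zpowers_iff_of_mul_self_eq_one h11]
    constructor
    · intro hg
      rcases hall g with rfl | rfl | rfl | rfl
      · exact Or.inl rfl
      · exact Or.inr rfl
      · exact absurd ((m₂ i).mp hg) (by omega)
      · exact absurd ((m₃ i).mp hg) (by omega)
    · rintro (rfl | rfl)
      · exact Subgroup.one_mem _
      · exact (m₁ i).mpr (by omega)
  -- `G_4 = ⊥`
  have hbot : 𝔓.ramificationSubgroup (L ≃ₐ[K] L) 4 = ⊥ := by
    rw [Subgroup.eq_bot_iff_forall]
    intro g hg
    rcases hall g with rfl | rfl | rfl | rfl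
    · rfl
    · exact absurd ((m₁ 4).mp hg) (by omega)
    · exact absurd ((m₂ 4).mp hg) (by omega)
    · exact absurd ((m₃ 4).mp hg) (by omega)
  refine ⟨?_, ?_, ?_, ?_, ?_⟩
  · rw [htop 0 (by norm_num), Subgroup.card_top, hG]
  · rw [htop 1 le_rfl, Subgroup.card_top, hG]
  · rw [hmid 2 le_rfl (by norm_num), Nat.card_zpowers, hz₁ord]
  · rw [hmid 3 (by norm_num) le_rfl, Nat.card_zpowers, hz₁ord]
  · rw [hbot, Subgroup.card_bot]

end Biquadratic

/-! ## Galois-setting wrappers (Serre IV §2 Ex. 3, Cor. 1 of Prop. 7; inertia of a quotient) -/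

section Wrapper

variable (R : Type*) {K L : Type*} [CommRing R] [IsDedekindDomain R] [Field K] [Field L]
  [Algebra R K] [IsFractionRing R K] [Algebra R L] [Algebra K L] [IsScalarTower R K L]
  [FiniteDimensional K L] [IsGalois K L]
  (𝔓 : Ideal (integralClosure R L)) [𝔓.IsMaximal]

/-- `i_G(ι) ≤ e + 1` for `ι ≠ 1` in `Gal(L/K)` when `2 ∈ 𝔓^e ∖ 𝔓^{e+1}`, `e ≥ 1` (`L/K` finite
Galois over a Dedekind domain `R`; `lowerIndex_le_of_ord_two` with the instances of the Galois
setting).  [cite: SerreLocalFields1979, Ch. IV §2 Exercise 3 (c) (p. 71)] -/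
theorem lowerIndex_le_of_ord_two_galois [Finite (integralClosure R L ⧸ 𝔓)] (hP : 𝔓 ≠ ⊥)
    {e : ℕ} (h2 : (2 : integralClosure R L) ∈ 𝔓 ^ e) (h2' : (2 : integralClosure R L) ∉ 𝔓 ^ (e + 1))
    (he : 1 ≤ e) {ι : L ≃ₐ[K] L} (hι : ι ≠ 1) :
    lowerIndex 𝔓 (L ≃ₐ[K] L) ι ≤ (e + 1 : ℕ) := by
  haveI : IsFractionRing (integralClosure R L) L :=
    integralClosure.isFractionRing_of_finite_extension K L
  haveI : FaithfulSMul (L ≃ₐ[K] L) (integralClosure R L) :=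
    (IsGaloisGroup.of_isFractionRing (L ≃ₐ[K] L) R (integralClosure R L) K L).faithful
  haveI : IsDedekindDomain (integralClosure R L) := integralClosure.isDedekindDomain R K L
  exact lowerIndex_le_of_ord_two hP h2 h2' he hι

/-- `σ ∈ G_i ⇒ σ² ∈ G_{min(2i, i+e)}` (`2 ∈ 𝔓^e`) in `Gal(L/K)` (`sq_mem_ramificationSubgroup_min`
with the instances of the Galois setting). [cite: SerreLocalFields1979, Ch. IV §2 Exercise 3 (a) (p. 71)] -/
theorem sq_mem_ramificationSubgroup_min_galois [Finite (integralClosure R L ⧸ 𝔓)] (hP : 𝔓 ≠ ⊥)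
    {σ : L ≃ₐ[K] L} (hσ0 : σ ∈ 𝔓.ramificationSubgroup (L ≃ₐ[K] L) 0) {i : ℕ}
    (hσ : σ ∈ 𝔓.ramificationSubgroup (L ≃ₐ[K] L) i) {e : ℕ} (h2 : (2 : integralClosure R L) ∈ 𝔓 ^ e) :
    σ ^ 2 ∈ 𝔓.ramificationSubgroup (L ≃ₐ[K] L) (min (2 * i) (i + e)) := by
  haveI : IsDedekindDomain (integralClosure R L) := integralClosure.isDedekindDomain R K L
  exact sq_mem_ramificationSubgroup_min hP hσ0 hσ h2

/-- **An even ramification index above `2` forces wild ramification** in `Gal(L/K)`: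
if `2 ∈ 𝔓` and `2 ∣ #G₀` then `G₁ ≠ 1` (`ramificationSubgroup_one_ne_bot_of_ringChar_dvd_card`,
the residue characteristic of `𝔓` being `2`). [cite: SerreLocalFields1979, Ch. IV §2 Cor. 1 of Prop. 7] -/
theorem ramificationSubgroup_one_ne_bot_of_two_dvd_card_galois [Finite (integralClosure R L ⧸ 𝔓)]
    (hP : 𝔓 ≠ ⊥) (h2 : (2 : integralClosure R L) ∈ 𝔓)
    (hdvd : 2 ∣ Nat.card (𝔓.ramificationSubgroup (L ≃ₐ[K] L) 0)) :
    𝔓.ramificationSubgroup (L ≃ₐ[K] L) 1 ≠ ⊥ := by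
  haveI : IsDedekindDomain (integralClosure R L) := integralClosure.isDedekindDomain R K L
  have hchar : ringChar (integralClosure R L ⧸ 𝔓) = 2 := by
    have h0 : ((2 : ℕ) : integralClosure R L ⧸ 𝔓) = 0 := by
      rw [← map_natCast (Ideal.Quotient.mk 𝔓), Ideal.Quotient.eq_zero_iff_mem]
      exact_mod_cast h2
    have hdvd2 : ringChar (integralClosure R L ⧸ 𝔓) ∣ 2 := (ringChar.spec _ _).mp h0
    haveI : Nontrivial (integralClosure R L ⧸ 𝔓) :=
      Ideal.Quotient.nontrivial_iff.mpr (Ideal.IsMaximal.ne_top inferInstance)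
    have hne1 : ringChar (integralClosure R L ⧸ 𝔓) ≠ 1 := by
      intro h1
      have := ringChar.Nat.cast_ringChar (R := integralClosure R L ⧸ 𝔓)
      rw [h1, Nat.cast_one] at this
      exact one_ne_zero this
    rcases (Nat.dvd_prime Nat.prime_two).mp hdvd2 with h | h
    · exact absurd h hne1
    · exact h
  refine ramificationSubgroup_one_ne_bot_of_ringChar_dvd_card hP ?_
  rw [hchar]
  exact hdvd

omit [IsDedekindDomain R] [IsFractionRing R K] [𝔓.IsMaximal] in
/-- **`#Q₀ ∣ #G₀`**: the inertia group of `𝔓 ∩ E` in `Gal(E/K)` is the image of that of `𝔓` in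
`Gal(L/K)` (Serre, Ch. I §7 Prop. 22; `map_inertia_restrictNormalHom`), so its order divides.
[cite: SerreLocalFields1979, Ch. I §7 Prop. 22] -/
theorem card_inertia_quotient_dvd (hprime : 𝔓.IsPrime) (E : IntermediateField K L) [Normal K E] :
    Nat.card ((𝔓.comap (E.integralClosureInclusion R)).ramificationSubgroup (E ≃ₐ[K] E) 0) ∣
      Nat.card (𝔓.ramificationSubgroup (L ≃ₐ[K] L) 0) := by
  haveI := hprime
  have hI : (𝔓.ramificationSubgroup (L ≃ₐ[K] L) 0).map (AlgEquiv.restrictNormalHom E) =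
      (𝔓.comap (E.integralClosureInclusion R)).ramificationSubgroup (E ≃ₐ[K] E) 0 := by
    rw [Ideal.ramificationSubgroup_zero, Ideal.ramificationSubgroup_zero]
    exact map_inertia_restrictNormalHom R E 𝔓
  rw [← hI]
  exact Subgroup.card_map_dvd _ _

end Wrapper


section RadicalQuadratic

variable {R : Type*} {K L : Type*} [CommRing R] [IsDedekindDomain R] [Field K] [Field L]
  [Algebra R K] [IsFractionRing R K] [Algebra R L] [Algebra K L] [IsScalarTower R K L]
  [FiniteDimensional K L] [IsGalois K L]
  (𝔓 : Ideal (integralClosure R L)) [𝔓.IsMaximal]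

include K in
/-- **Index `3` for `√(2a)`, `a` a unit, over a base with `v(2) = 1`**: for `L/K` quadratic,
`θ ∈ S_L` with `θ² = 2a`, `v_𝔭(2) = 1`, `v_𝔭(a) = 0`, and `σ θ ≠ θ`:  `X² - 2a` is Eisenstein,
so `i_G(σ) = v_𝔓(2θ) = 2 v_𝔭(2) + 1 = 3` (`lowerIndex_eq_ord_of_quadratic`,
`ord_two_mul_root_add_eq`).  [cite: SerreLocalFields1979, Ch. IV §1 Prop. 2–3 and §2 Prop. 5] -/
theorem lowerIndex_eq_three_of_sq_eq_two_mul
    [Algebra.IsSeparable (R ⧸ 𝔓.under R) (integralClosure R L ⧸ 𝔓)]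
    (h𝔓 : 𝔓 ≠ ⊥) (hG : Nat.card (L ≃ₐ[K] L) = 2) {θ : integralClosure R L} {a : R}
    (hθ : θ ^ 2 = algebraMap R _ (2 * a)) (h2 : ord (𝔓.under R) (2 : R) = 1)
    (ha : ord (𝔓.under R) a = 0) {σ : L ≃ₐ[K] L} (hσ : σ • θ ≠ θ) :
    lowerIndex 𝔓 (L ≃ₐ[K] L) σ = (3 : ℕ) := by
  haveI : (𝔓.under R).IsPrime := Ideal.IsPrime.under R 𝔓
  have h2mem : (2 : R) ∈ 𝔓.under R := by
    have := (mem_pow_iff_le_ord (𝔓.under R) (b := (2 : R)) (n := 1)).mpr (by rw [h2]; exact le_rfl)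
    rwa [pow_one] at this
  have h20 : (2 : R) ≠ 0 := fun h => by
    rw [h, ord_zero] at h2
    exact ENat.top_ne_coe 1 h2
  have hp : 𝔓.under R ≠ ⊥ := fun h0 => h20 (by rw [h0, Ideal.mem_bot] at h2mem; exact h2mem)
  have hθ' : θ ^ 2 + algebraMap R _ (0 : R) * θ + algebraMap R _ (-(2 * a)) = 0 := by
    rw [map_zero, zero_mul, add_zero, map_neg, hθ, add_neg_cancel]
  have hc₁ : (0 : R) ∈ 𝔓.under R := zero_mem _
  have hc₀ : -(2 * a) ∈ 𝔓.under R := neg_mem (Ideal.mul_mem_right _ _ h2mem)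
  have hc₀' : -(2 * a) ∉ (𝔓.under R) ^ 2 := by
    intro h
    have h' : 2 * a ∈ (𝔓.under R) ^ 2 := by simpa using neg_mem h
    have hle := (mem_pow_iff_le_ord (𝔓.under R)).mp h'
    rw [ord_mul _ hp, h2, ha, add_zero] at hle
    exact absurd (by exact_mod_cast hle : (2 : ℕ) ≤ 1) (by norm_num)
  rw [lowerIndex_eq_ord_of_quadratic (K := K) 𝔓 h𝔓 hG hθ' hc₁ hc₀ hc₀' hσ,
    ord_two_mul_root_add_eq (K := K) 𝔓 h𝔓 hG hθ' hc₁ hc₀ hc₀', h2, ord_zero,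
    ENat.mul_top (by norm_num), min_eq_left le_top]
  norm_num

include K in
/-- **Index `2` for the ramified unit type**: `L/K` quadratic and totally ramified at `𝔓`
(`σ ≠ 1` in `G₀`), residue characteristic `2` with `v_𝔭(2) = 1`, and a unit `P ∈ S_L`
(`v_𝔓(P) = 0`) with `σ P = -P`.  Then `i_G(σ) = 2`: `σ ∈ G₁` as `#G₀ = 2` is even
(`ramificationSubgroup_one_ne_bot_of_two_dvd_card_galois`), and `σ ∉ G₂` since
`σ P - P = -2P` has `v_𝔓(2P) = e(𝔓|𝔭) ≤ 2 < 3`.  (Over `ℚ₂`: `ℚ₂(√u)`, `u ≡ 3 mod 4`, or more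
generally the quadratic extensions of break `1`.)  [cite: SerreLocalFields1979, Ch. IV §1 Prop. 2 and §2 Cor. 1 of Prop. 7] -/
theorem lowerIndex_eq_two_of_smul_eq_neg [Finite (integralClosure R L ⧸ 𝔓)]
    [Algebra.IsSeparable (R ⧸ 𝔓.under R) (integralClosure R L ⧸ 𝔓)]
    (h𝔓 : 𝔓 ≠ ⊥) (hG : Nat.card (L ≃ₐ[K] L) = 2) {σ : L ≃ₐ[K] L} (hσ1 : σ ≠ 1)
    (hσ0 : σ ∈ 𝔓.ramificationSubgroup (L ≃ₐ[K] L) 0) (h2 : ord (𝔓.under R) (2 : R) = 1)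
    {P : integralClosure R L} (hP : ord 𝔓 P = 0) (hσP : σ • P = -P) :
    lowerIndex 𝔓 (L ≃ₐ[K] L) σ = (2 : ℕ) := by
  classical
  haveI : IsDedekindDomain (integralClosure R L) := integralClosure.isDedekindDomain R K L
  haveI : (𝔓.under R).IsPrime := Ideal.IsPrime.under R 𝔓
  have h2mem : (2 : R) ∈ 𝔓.under R := by
    have := (mem_pow_iff_le_ord (𝔓.under R) (b := (2 : R)) (n := 1)).mpr (by rw [h2]; exact le_rfl)
    rwa [pow_one] at this
  have h2S : (2 : integralClosure R L) ∈ 𝔓 := by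
    rw [show (2 : integralClosure R L) = algebraMap R _ 2 from (map_ofNat _ 2).symm]
    exact Ideal.mem_comap.mp h2mem
  -- `G = {1, σ} = G₀`
  have hall : ∀ g : L ≃ₐ[K] L, g = 1 ∨ g = σ := by
    intro g
    by_contra h
    push Not at h
    haveI : Fintype (L ≃ₐ[K] L) := Fintype.ofFinite _
    have h3 : ({1, σ, g} : Finset (L ≃ₐ[K] L)).card = 3 := by
      rw [Finset.card_insert_of_notMem, Finset.card_pair (Ne.symm h.2)]
      simp only [Finset.mem_insert, Finset.mem_singleton, not_or]
      exact ⟨Ne.symm hσ1, Ne.symm h.1⟩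
    have hle : ({1, σ, g} : Finset (L ≃ₐ[K] L)).card ≤ Fintype.card (L ≃ₐ[K] L) :=
      Finset.card_le_univ _
    rw [h3, ← Nat.card_eq_fintype_card, hG] at hle
    omega
  have htop : 𝔓.ramificationSubgroup (L ≃ₐ[K] L) 0 = ⊤ := by
    ext g
    simp only [Subgroup.mem_top, iff_true]
    rcases hall g with rfl | rfl
    · exact Subgroup.one_mem _
    · exact hσ0
  -- `σ ∈ G₁`
  have hne1 := ramificationSubgroup_one_ne_bot_of_two_dvd_card_galois R (K := K) 𝔓 h𝔓 h2S
    (by rw [htop, Subgroup.card_top, hG])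
  have hσG1 : σ ∈ 𝔓.ramificationSubgroup (L ≃ₐ[K] L) 1 := by
    obtain ⟨⟨g, hg⟩, hg1⟩ := Subgroup.ne_bot_iff_exists_ne_one.mp hne1
    have hg1' : g ≠ 1 := fun h => hg1 (Subtype.ext h)
    rcases hall g with h | h
    · exact absurd h hg1'
    · exact h ▸ hg
  -- `σ ∉ G₂`
  have hσG2 : σ ∉ 𝔓.ramificationSubgroup (L ≃ₐ[K] L) 2 := by
    intro hmem
    have h := (Ideal.mem_ramificationSubgroup_iff.mp hmem).2 P
    rw [hσP, show -P - P = -(2 * P) by ring] at h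
    have h' : 2 * P ∈ 𝔓 ^ 3 := by simpa using neg_mem h
    have hle := (mem_pow_iff_le_ord 𝔓).mp h'
    have he : (𝔓.under R).ramificationIdx' 𝔓 ≤ 2 := by
      rw [ramificationIdx'_under_base_eq_card_inertia (K := K) 𝔓 h𝔓, ← hG]
      exact Subgroup.card_le_card_group _
    rw [ord_mul _ h𝔓, hP, add_zero,
      show (2 : integralClosure R L) = algebraMap R _ 2 from (map_ofNat _ 2).symm,
      ord_algebraMap (K := K) 𝔓 h𝔓, h2, mul_one] at hle
    have : (3 : ℕ) ≤ (𝔓.under R).ramificationIdx' 𝔓 := by exact_mod_cast hle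
    omega
  -- conclude
  apply le_antisymm
  · by_contra hlt
    rw [not_le] at hlt
    have h3 : ((2 : ℕ) : ℕ∞) + 1 ≤ lowerIndex 𝔓 (L ≃ₐ[K] L) σ :=
      (ENat.add_one_le_iff (ENat.coe_ne_top 2)).mpr (by exact_mod_cast hlt)
    exact hσG2 ((add_one_le_lowerIndex_iff 𝔓).mp (by exact_mod_cast h3))
  · have := (add_one_le_lowerIndex_iff 𝔓).mpr hσG1
    exact_mod_cast this

include K in
/-- **The filtration `(2, 2, 2, 1)` from a radical**: `L/K` quadratic with `σ ≠ 1`, `θ ∈ S_L`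
with `θ² = 2a` (`a` a unit, `v_𝔭(2) = 1`) and `σ θ = -θ`: the index of `σ` is `3`, so
`#G₀ = #G₁ = #G₂ = 2`, `#G₃ = 1` (e.g. `ℚ₂(√2)`, `ℚ₂(√10)` over `ℚ₂`: break `2`).
[cite: SerreLocalFields1979, Ch. IV §1 Prop. 2–3 and §2 Prop. 5] -/
theorem card_ramificationSubgroup_of_quadratic_radical
    [Algebra.IsSeparable (R ⧸ 𝔓.under R) (integralClosure R L ⧸ 𝔓)]
    (h𝔓 : 𝔓 ≠ ⊥) (hG : Nat.card (L ≃ₐ[K] L) = 2) (h2 : ord (𝔓.under R) (2 : R) = 1)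
    {θ : integralClosure R L} {a : R} (hθ : θ ^ 2 = algebraMap R _ (2 * a))
    (ha : ord (𝔓.under R) a = 0) {σ : L ≃ₐ[K] L} (hσ1 : σ ≠ 1) (hσθ : σ • θ = -θ)
    (hθ0 : θ ≠ 0) :
    Nat.card (𝔓.ramificationSubgroup (L ≃ₐ[K] L) 0) = 2 ∧
      Nat.card (𝔓.ramificationSubgroup (L ≃ₐ[K] L) 1) = 2 ∧
      Nat.card (𝔓.ramificationSubgroup (L ≃ₐ[K] L) 2) = 2 ∧
      Nat.card (𝔓.ramificationSubgroup (L ≃ₐ[K] L) 3) = 1 := by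
  have hσ : σ • θ ≠ θ := by
    intro h
    rw [hσθ] at h
    have h1 := congrArg (fun x : integralClosure R L => (x : L)) h
    simp only [NegMemClass.coe_neg] at h1
    have h3 : (2 : L) * θ = 0 := by linear_combination -h1
    rcases mul_eq_zero.mp h3 with h4 | h4
    · have h20 : (2 : R) ≠ 0 := fun h0 => by
        rw [h0, ord_zero] at h2
        exact ENat.top_ne_coe 1 h2
      have h5 : algebraMap R L 2 = algebraMap R L 0 := by rw [map_ofNat, map_zero]; exact h4
      rw [IsScalarTower.algebraMap_apply R K L, IsScalarTower.algebraMap_apply R K L 0] at h5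
      exact h20 (IsFractionRing.injective R K ((algebraMap K L).injective h5))
    · exact hθ0 (Subtype.ext (by simpa using h4))
  have hn := lowerIndex_eq_three_of_sq_eq_two_mul (K := K) 𝔓 h𝔓 hG hθ h2 ha hσ
  refine ⟨?_, ?_, ?_, ?_⟩
  · rw [card_ramificationSubgroup_of_card_eq_two 𝔓 hG hσ1 hn 0]; rfl
  · rw [card_ramificationSubgroup_of_card_eq_two 𝔓 hG hσ1 hn 1]; rfl
  · rw [card_ramificationSubgroup_of_card_eq_two 𝔓 hG hσ1 hn 2]; rfl
  · rw [card_ramificationSubgroup_of_card_eq_two 𝔓 hG hσ1 hn 3]; rfl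

end RadicalQuadratic

/-! ## Quadratic subfields cut out by an involution: level-`E` data from level-`L` radicals -/

section Sublevel

variable (R : Type*) {K L : Type*} [CommRing R] [IsDedekindDomain R] [Field K] [Field L]
  [Algebra R K] [IsFractionRing R K] [Algebra R L] [Algebra K L] [IsScalarTower R K L]
  [FiniteDimensional K L] [IsGalois K L]
  (𝔓 : Ideal (integralClosure R L)) [𝔓.IsMaximal]

omit [IsDedekindDomain R] [IsFractionRing R K] [𝔓.IsMaximal] in
/-- `#Gal(L^{⟨z⟩}/K) = 2` for an involution `z ≠ 1` of a Galois group of order `4`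
(`[L : L^{⟨z⟩}] = 2`, tower law). [folklore] -/
theorem card_aut_fixedField_zpowers_eq_two (hG : Nat.card (L ≃ₐ[K] L) = 4) {z : L ≃ₐ[K] L}
    (hz : z * z = 1) (hz1 : z ≠ 1)
    [IsGalois K (IntermediateField.fixedField (Subgroup.zpowers z))] :
    Nat.card (IntermediateField.fixedField (Subgroup.zpowers z) ≃ₐ[K]
      IntermediateField.fixedField (Subgroup.zpowers z)) = 2 := by
  have hord : orderOf z = 2 := orderOf_eq_prime (by rw [pow_two]; exact hz) hz1
  have h1 : Module.finrank (IntermediateField.fixedField (Subgroup.zpowers z)) L = 2 := by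
    rw [IntermediateField.finrank_fixedField_eq_card, Nat.card_zpowers, hord]
  have h2 : Module.finrank K L = 4 := by rw [← IsGalois.card_aut_eq_finrank, hG]
  have h3 := Module.finrank_mul_finrank K (IntermediateField.fixedField (Subgroup.zpowers z)) L
  rw [h1, h2] at h3
  rw [IsGalois.card_aut_eq_finrank]
  omega

/-- **Index `3` on the quadratic subfield `E = L^{⟨z⟩}` from a level-`L` radical**: for
`θ ∈ S_L` fixed by the involution `z` and negated by `w`, with `θ² = 2a`, `v_𝔭(2) = 1`,
`v_𝔭(a) = 0`: the restriction of `w` to `E` has index `3` at `𝔓 ∩ E`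
(`lowerIndex_eq_three_of_sq_eq_two_mul` for `E/K` and the copy of `θ` in `S_E`).
[cite: SerreLocalFields1979, Ch. IV §1 Prop. 2–3 and §2 Prop. 5] -/
theorem lowerIndex_restrictNormalHom_eq_three
    [Algebra.IsSeparable (R ⧸ 𝔓.under R) (integralClosure R L ⧸ 𝔓)]
    (h𝔓 : 𝔓 ≠ ⊥) (hG : Nat.card (L ≃ₐ[K] L) = 4) {z w : L ≃ₐ[K] L} (hz : z * z = 1)
    (hz1 : z ≠ 1) [IsGalois K (IntermediateField.fixedField (Subgroup.zpowers z))]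
    (h2 : ord (𝔓.under R) (2 : R) = 1) {θ : integralClosure R L} {a : R}
    (hθ : θ ^ 2 = algebraMap R _ (2 * a)) (ha : ord (𝔓.under R) a = 0)
    (hzθ : z • θ = θ) (hwθ : w • θ = -θ) (hθ0 : θ ≠ 0) :
    lowerIndex (𝔓.comap ((IntermediateField.fixedField (Subgroup.zpowers z)).integralClosureInclusion R))
      (IntermediateField.fixedField (Subgroup.zpowers z) ≃ₐ[K]
        IntermediateField.fixedField (Subgroup.zpowers z))
      (AlgEquiv.restrictNormalHom (IntermediateField.fixedField (Subgroup.zpowers z)) w) =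
      (3 : ℕ) := by
  set E := IntermediateField.fixedField (Subgroup.zpowers z) with hE
  letI := integralClosureAlgebra R (K := K) (L := L) E
  haveI := integralClosure_isIntegral R (K := K) (L := L) E
  haveI : IsDedekindDomain (integralClosure R E) := integralClosure.isDedekindDomain R K E
  haveI : (𝔓.comap (E.integralClosureInclusion R)).IsMaximal := isMaximal_under_integralClosure R E 𝔓
  have h𝔓E0 : 𝔓.comap (E.integralClosureInclusion R) ≠ ⊥ := Ideal.IsIntegral.comap_ne_bot _ h𝔓
  haveI : Algebra.IsSeparable (R ⧸ (𝔓.comap (E.integralClosureInclusion R)).under R)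
      (integralClosure R E ⧸ 𝔓.comap (E.integralClosureInclusion R)) :=
    isSeparable_residue_bot R E 𝔓
  -- `θ ∈ E`, integral: the copy `θ'` of `θ` in `S_E`
  have hθE : (θ : L) ∈ E := by
    rw [hE, IntermediateField.mem_fixedField_iff]
    intro g hg
    rcases (mem_zpowers_iff_of_mul_self_eq_one hz g).mp hg with rfl | rfl
    · rfl
    · have := congrArg (fun x : integralClosure R L => (x : L)) hzθ
      simpa only [integralClosure.coe_smul, AlgEquiv.smul_def] using this
  have hθint : IsIntegral R (⟨(θ : L), hθE⟩ : E) := by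
    rw [← isIntegral_algHom_iff (E.val.restrictScalars R)
      ((E.val.restrictScalars R).toRingHom.injective)]
    exact θ.2
  set θ' : integralClosure R E := ⟨⟨(θ : L), hθE⟩, hθint⟩ with hθ'
  have hincl : E.integralClosureInclusion R θ' = θ := Subtype.ext rfl
  -- data for `lowerIndex_eq_three_of_sq_eq_two_mul` at level `E`
  have hcard := card_aut_fixedField_zpowers_eq_two (K := K) (L := L) hG hz hz1
  have hunder : (𝔓.comap (E.integralClosureInclusion R)).under R = 𝔓.under R :=
    Ideal.under_under 𝔓
  have hθ'sq : θ' ^ 2 = algebraMap R (integralClosure R E) (2 * a) := by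
    apply (E.integralClosureInclusion_injective R)
    rw [map_pow, hincl, hθ, AlgHom.commutes]
  have hσ : AlgEquiv.restrictNormalHom E w • θ' ≠ θ' := by
    intro h
    have h1 := congrArg (fun x : integralClosure R E => ((x : E) : L)) h
    simp only [integralClosure.coe_smul, AlgEquiv.smul_def, hθ',
      AlgEquiv.restrictNormalHom_apply] at h1
    have hw2 := congrArg (fun x : integralClosure R L => (x : L)) hwθ
    simp only [integralClosure.coe_smul, AlgEquiv.smul_def, NegMemClass.coe_neg] at hw2
    rw [hw2] at h1
    have h3 : (2 : L) * θ = 0 := by linear_combination -h1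
    rcases mul_eq_zero.mp h3 with h4 | h4
    · -- `2 ≠ 0` in `L`: `v_𝔭(2) = 1 < ∞`
      have h20 : (2 : R) ≠ 0 := fun h0 => by
        rw [h0, ord_zero] at h2
        exact ENat.top_ne_coe 1 h2
      have h5 : algebraMap R L 2 = algebraMap R L 0 := by rw [map_ofNat, map_zero]; exact h4
      rw [IsScalarTower.algebraMap_apply R K L, IsScalarTower.algebraMap_apply R K L 0] at h5
      exact h20 (IsFractionRing.injective R K ((algebraMap K L).injective h5))
    · exact hθ0 (Subtype.ext (by simpa using h4))
  have h2E : ord ((𝔓.comap (E.integralClosureInclusion R)).under R) (2 : R) = 1 := by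
    rw [hunder]; exact h2
  have haE : ord ((𝔓.comap (E.integralClosureInclusion R)).under R) a = 0 := by
    rw [hunder]; exact ha
  exact lowerIndex_eq_three_of_sq_eq_two_mul (K := K) (𝔓.comap (E.integralClosureInclusion R))
    h𝔓E0 hcard hθ'sq h2E haE hσ

/-- **Index `2` on the quadratic subfield `E = L^{⟨z⟩}` from a level-`L` unit**: for a unit
`P ∈ S_L` fixed by the involution `z` and negated by `w ∈ G₀`, `w ∉ {1, z}`, with `v_𝔭(2) = 1`
and `#G = 4`: the restriction of `w` to `E` has index `2` at `𝔓 ∩ E`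
(`lowerIndex_eq_two_of_smul_eq_neg` for `E/K` and the copy of `P` in `S_E`).
[cite: SerreLocalFields1979, Ch. IV §1 Prop. 2 and §2 Cor. 1 of Prop. 7] -/
theorem lowerIndex_restrictNormalHom_eq_two [Finite (integralClosure R L ⧸ 𝔓)]
    [Algebra.IsSeparable (R ⧸ 𝔓.under R) (integralClosure R L ⧸ 𝔓)]
    (h𝔓 : 𝔓 ≠ ⊥) (hG : Nat.card (L ≃ₐ[K] L) = 4) {z w : L ≃ₐ[K] L} (hz : z * z = 1)
    (hz1 : z ≠ 1) [IsGalois K (IntermediateField.fixedField (Subgroup.zpowers z))]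
    (hw1 : w ≠ 1) (hwz : w ≠ z) (hw0 : w ∈ 𝔓.ramificationSubgroup (L ≃ₐ[K] L) 0)
    (h2 : ord (𝔓.under R) (2 : R) = 1) {P : integralClosure R L}
    (hP : ord 𝔓 P = 0) (hzP : z • P = P) (hwP : w • P = -P) :
    lowerIndex (𝔓.comap ((IntermediateField.fixedField (Subgroup.zpowers z)).integralClosureInclusion R))
      (IntermediateField.fixedField (Subgroup.zpowers z) ≃ₐ[K]
        IntermediateField.fixedField (Subgroup.zpowers z))
      (AlgEquiv.restrictNormalHom (IntermediateField.fixedField (Subgroup.zpowers z)) w) =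
      (2 : ℕ) := by
  set E := IntermediateField.fixedField (Subgroup.zpowers z) with hE
  letI := integralClosureAlgebra R (K := K) (L := L) E
  haveI := integralClosure_isIntegral R (K := K) (L := L) E
  haveI : IsDedekindDomain (integralClosure R L) := integralClosure.isDedekindDomain R K L
  haveI : IsDedekindDomain (integralClosure R E) := integralClosure.isDedekindDomain R K E
  haveI : (𝔓.comap (E.integralClosureInclusion R)).IsMaximal := isMaximal_under_integralClosure R E 𝔓
  have h𝔓E0 : 𝔓.comap (E.integralClosureInclusion R) ≠ ⊥ := Ideal.IsIntegral.comap_ne_bot _ h𝔓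
  haveI : Algebra.IsSeparable (R ⧸ (𝔓.comap (E.integralClosureInclusion R)).under R)
      (integralClosure R E ⧸ 𝔓.comap (E.integralClosureInclusion R)) :=
    isSeparable_residue_bot R E 𝔓
  haveI : Finite (integralClosure R E ⧸ 𝔓.comap (E.integralClosureInclusion R)) :=
    Finite.of_injective _ (Ideal.algebraMap_quotient_injective (R := integralClosure R E)
      (A := integralClosure R L) (I := 𝔓))
  -- the copy `P'` of `P` in `S_E`
  have hPE : (P : L) ∈ E := by
    rw [hE, IntermediateField.mem_fixedField_iff]
    intro g hg
    rcases (mem_zpowers_iff_of_mul_self_eq_one hz g).mp hg with rfl | rfl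
    · rfl
    · have := congrArg (fun x : integralClosure R L => (x : L)) hzP
      simpa only [integralClosure.coe_smul, AlgEquiv.smul_def] using this
  have hPint : IsIntegral R (⟨(P : L), hPE⟩ : E) := by
    rw [← isIntegral_algHom_iff (E.val.restrictScalars R)
      ((E.val.restrictScalars R).toRingHom.injective)]
    exact P.2
  set P' : integralClosure R E := ⟨⟨(P : L), hPE⟩, hPint⟩ with hP'
  have hincl : E.integralClosureInclusion R P' = P := Subtype.ext rfl
  -- hypotheses of `lowerIndex_eq_two_of_smul_eq_neg` at level `E`
  have hcard := card_aut_fixedField_zpowers_eq_two (K := K) (L := L) hG hz hz1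
  have hunder : (𝔓.comap (E.integralClosureInclusion R)).under R = 𝔓.under R :=
    Ideal.under_under 𝔓
  have hσ1 : AlgEquiv.restrictNormalHom E w ≠ 1 := by
    intro h
    rcases (restrictNormalHom_fixedField_eq_one_iff (K := K) (L := L) hz w).mp h with h' | h'
    · exact hw1 h'
    · exact hwz h'
  have hσ0 : AlgEquiv.restrictNormalHom E w ∈
      (𝔓.comap (E.integralClosureInclusion R)).ramificationSubgroup (E ≃ₐ[K] E) 0 := by
    rw [Ideal.ramificationSubgroup_zero, ← map_inertia_restrictNormalHom R E 𝔓]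
    rw [Ideal.ramificationSubgroup_zero] at hw0
    exact Subgroup.mem_map_of_mem _ hw0
  have hP'ord : ord (𝔓.comap (E.integralClosureInclusion R)) P' = 0 := by
    have hPnot : P ∉ 𝔓 := by
      intro hmem
      have := (mem_pow_iff_le_ord 𝔓 (b := P) (n := 1)).mp (by rwa [pow_one])
      rw [hP] at this
      exact absurd (by exact_mod_cast this : (1 : ℕ) ≤ 0) (by norm_num)
    have hP'not : P' ∉ 𝔓.comap (E.integralClosureInclusion R) := by
      rw [Ideal.mem_comap, hincl]; exact hPnot
    by_contra hne
    have h1 : (1 : ℕ∞) ≤ ord (𝔓.comap (E.integralClosureInclusion R)) P' :=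
      Order.one_le_iff_ne_zero.mpr hne
    apply hP'not
    have := (mem_pow_iff_le_ord (𝔓.comap (E.integralClosureInclusion R)) (b := P') (n := 1)).mpr
      (by exact_mod_cast h1)
    rwa [pow_one] at this
  have hσP' : AlgEquiv.restrictNormalHom E w • P' = -P' := by
    apply E.integralClosureInclusion_injective R
    rw [E.integralClosureInclusion_restrictNormalHom_smul R, hincl, hwP, map_neg, hincl]
  have h2E : ord ((𝔓.comap (E.integralClosureInclusion R)).under R) (2 : R) = 1 := by
    rw [hunder]; exact h2
  exact lowerIndex_eq_two_of_smul_eq_neg (K := K) (𝔓.comap (E.integralClosureInclusion R))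
    h𝔓E0 hcard hσ1 hσ0 h2E hP'ord hσP'

/-- **The filtration `(4, 4, 2, 2, 1)` from radicals** (the Galois side of Ogg's formula at `2` for
the odd classes): `L/K` Galois of order `4`, totally ramified at `𝔓` (`z₁, z₂ ∈ G₀` commuting
involutions generating `G`), residue characteristic `2` with `v_𝔭(2) = 1` (finite separable
residue data), and elements `θ₂, θ₃, P ∈ S_L` with `θ₂² = 2a₂`, `θ₃² = 2a₃` (`a₂, a₃` units),
`P` a unit at `𝔓`, on which `z₁ = (-,-,+)`, `z₂ = (+,-,-)` act by the indicated signs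
(`z₂ θ₂ = θ₂`, `z₁ θ₂ = -θ₂`; `z₁z₂ θ₃ = θ₃`, `z₁ θ₃ = -θ₃`; `z₁ P = P`, `z₂ P = -P`).  Then the
three quadratic subfields `L^{z₁} ∋ P`, `L^{z₂} ∋ θ₂`, `L^{z₁z₂} ∋ θ₃` have indices `(2, 3, 3)`
and **`#G₀ = #G₁ = 4`, `#G₂ = #G₃ = 2`, `#G₄ = 1`**
(`card_ramificationSubgroup_of_biquadratic_two_three_three`).  Over `ℚ₂^{nr}`: `L = K(√A₁, √A₂)`
with `v(A₁) = v(A₂)` odd and `A₁A₂/4^k` a non-square unit, e.g. `ℚ₂(ζ₈)`.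
[cite: SerreLocalFields1979, Ch. IV §1 Prop. 2–3 and §2 Prop. 5] -/
theorem card_ramificationSubgroup_of_biquadratic_radical [Finite (integralClosure R L ⧸ 𝔓)]
    [Algebra.IsSeparable (R ⧸ 𝔓.under R) (integralClosure R L ⧸ 𝔓)]
    (h𝔓 : 𝔓 ≠ ⊥) (hG : Nat.card (L ≃ₐ[K] L) = 4) {z₁ z₂ : L ≃ₐ[K] L}
    (h11 : z₁ * z₁ = 1) (h22 : z₂ * z₂ = 1) (hcomm : z₁ * z₂ = z₂ * z₁)
    (hz₁ : z₁ ≠ 1) (hz₂ : z₂ ≠ 1) (h12 : z₁ ≠ z₂)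
    (hz₁0 : z₁ ∈ 𝔓.ramificationSubgroup (L ≃ₐ[K] L) 0)
    (hz₂0 : z₂ ∈ 𝔓.ramificationSubgroup (L ≃ₐ[K] L) 0)
    (h2 : ord (𝔓.under R) (2 : R) = 1)
    {θ₂ θ₃ P : integralClosure R L} {a₂ a₃ : R}
    (hθ₂ : θ₂ ^ 2 = algebraMap R _ (2 * a₂)) (ha₂ : ord (𝔓.under R) a₂ = 0)
    (hz₂θ₂ : z₂ • θ₂ = θ₂) (hz₁θ₂ : z₁ • θ₂ = -θ₂) (hθ₂0 : θ₂ ≠ 0)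
    (hθ₃ : θ₃ ^ 2 = algebraMap R _ (2 * a₃)) (ha₃ : ord (𝔓.under R) a₃ = 0)
    (hz₃θ₃ : (z₁ * z₂) • θ₃ = θ₃) (hz₁θ₃ : z₁ • θ₃ = -θ₃) (hθ₃0 : θ₃ ≠ 0)
    (hP : ord 𝔓 P = 0) (hz₁P : z₁ • P = P) (hz₂P : z₂ • P = -P) :
    Nat.card (𝔓.ramificationSubgroup (L ≃ₐ[K] L) 0) = 4 ∧
      Nat.card (𝔓.ramificationSubgroup (L ≃ₐ[K] L) 1) = 4 ∧
      Nat.card (𝔓.ramificationSubgroup (L ≃ₐ[K] L) 2) = 2 ∧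
      Nat.card (𝔓.ramificationSubgroup (L ≃ₐ[K] L) 3) = 2 ∧
      Nat.card (𝔓.ramificationSubgroup (L ≃ₐ[K] L) 4) = 1 := by
  -- the group: `G = {1, z₁, z₂, z₁z₂}` is commutative, so every `⟨z⟩` is normal
  have hall := eq_of_card_eq_four hG h22 hz₁ hz₂ h12
  have h33 : z₁ * z₂ * (z₁ * z₂) = 1 := by
    calc z₁ * z₂ * (z₁ * z₂) = z₁ * (z₂ * z₁) * z₂ := by simp only [mul_assoc]
      _ = z₁ * (z₁ * z₂) * z₂ := by rw [← hcomm]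
      _ = (z₁ * z₁) * (z₂ * z₂) := by simp only [mul_assoc]
      _ = 1 := by rw [h11, h22, one_mul]
  have hz₃ : z₁ * z₂ ≠ 1 := by
    intro h
    apply h12
    calc z₁ = z₁ * (z₂ * z₂) := by rw [h22, mul_one]
      _ = z₁ * z₂ * z₂ := by rw [mul_assoc]
      _ = z₂ := by rw [h, one_mul]
  have hcommall : ∀ a b : L ≃ₐ[K] L, a * b = b * a := by
    have hc : ∀ b : L ≃ₐ[K] L, z₁ * b = b * z₁ := by
      intro b
      rcases hall b with rfl | rfl | rfl | rfl
      · rw [one_mul, mul_one]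
      · rfl
      · exact hcomm
      · rw [← mul_assoc, h11, one_mul, mul_assoc, ← hcomm, ← mul_assoc, h11, one_mul]
    have hc' : ∀ b : L ≃ₐ[K] L, z₂ * b = b * z₂ := by
      intro b
      rcases hall b with rfl | rfl | rfl | rfl
      · rw [one_mul, mul_one]
      · exact hcomm.symm
      · rfl
      · rw [← mul_assoc, ← hcomm]
    intro a b
    rcases hall a with rfl | rfl | rfl | rfl
    · rw [one_mul, mul_one]
    · exact hc b
    · exact hc' b
    · rw [mul_assoc, hc' b, ← mul_assoc, hc b, mul_assoc]
  have hnormal : ∀ z : L ≃ₐ[K] L, (Subgroup.zpowers z).Normal := fun z =>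
    ⟨fun n hn g => by rwa [hcommall g n, mul_inv_cancel_right]⟩
  haveI := hnormal z₁
  haveI := hnormal z₂
  haveI := hnormal (z₁ * z₂)
  haveI hG₁ : IsGalois K (IntermediateField.fixedField (Subgroup.zpowers z₁)) :=
    IsGalois.of_fixedField_normal_subgroup _
  haveI hG₂ : IsGalois K (IntermediateField.fixedField (Subgroup.zpowers z₂)) :=
    IsGalois.of_fixedField_normal_subgroup _
  haveI hG₃ : IsGalois K (IntermediateField.fixedField (Subgroup.zpowers (z₁ * z₂))) :=
    IsGalois.of_fixedField_normal_subgroup _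
  -- kernels
  have hker₁ := restrictNormalHom_fixedField_eq_one_iff (K := K) (L := L) h11
  have hker₂ := restrictNormalHom_fixedField_eq_one_iff (K := K) (L := L) h22
  have hker₃ := restrictNormalHom_fixedField_eq_one_iff (K := K) (L := L) h33
  -- the three indices
  have hz₁z₂0 : z₁ * z₂ ∈ 𝔓.ramificationSubgroup (L ≃ₐ[K] L) 0 := Subgroup.mul_mem _ hz₁0 hz₂0
  have hn₁ := lowerIndex_restrictNormalHom_eq_two R 𝔓 h𝔓 hG h11 hz₁ hz₂ (Ne.symm h12) hz₂0 h2
    hP hz₁P hz₂P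
  have hn₂ := lowerIndex_restrictNormalHom_eq_three R 𝔓 h𝔓 hG h22 hz₂ h2 hθ₂ ha₂ hz₂θ₂ hz₁θ₂
    hθ₂0
  have hn₃ := lowerIndex_restrictNormalHom_eq_three R 𝔓 h𝔓 hG h33 hz₃ h2 hθ₃ ha₃ hz₃θ₃ hz₁θ₃
    hθ₃0
  exact card_ramificationSubgroup_of_biquadratic_two_three_three R 𝔓 hG
    (IntermediateField.fixedField (Subgroup.zpowers z₁))
    (IntermediateField.fixedField (Subgroup.zpowers z₂))
    (IntermediateField.fixedField (Subgroup.zpowers (z₁ * z₂)))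
    h11 h22 hcomm hz₁ hz₂ h12 hz₁0 hz₂0 hker₁ hker₂ hker₃ hn₁ hn₂ hn₃

end Sublevel

end Literature.NumberTheory.GaloisRepresentations
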